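import Summits.HodgeConjecture.CorCM.DihedralSexticPairCurveHodgeOfMarkmanConcrete
import Literature.AlgebraicGeometry.ComplexMultiplication.SimpleIffPrimitiveCMType
import Literature.AlgebraicGeometry.ComplexMultiplication.CMTypeGaloisConjugateIsogeny
import HarnessLib

/-!
# COR-CM — the Hodge conjecture, modulo Markman's fourfold theorem, for `B₀ × B₁` and `E × B₀ × B₁` with GEOMETRIC
# hypotheses: `B₀, B₁` SIMPLE and NOT ISOGENOUS CM threefolds of a non-Galois sextic CM field `K ⊇ k`

Cell `pub-hodgecm2` (COR-CM), seat b30 gen 14 (2026-08-21); COUNT-NEUTRAL; theorems only, no definition, no named fact,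
no `sorry`.  The CM-type hypotheses of `CorCM/DihedralSexticPairHodgeOfMarkmanNonGalois.lean` and
`CorCM/DihedralSexticPairCurveHodgeOfMarkman{NonGalois,Concrete}.lean` —

* `hprim : ∃ s ∈ Φ_m, ∃ s' ∈ Φ_m, s ∘ i ≠ s' ∘ i` (the type is not induced from `k` along `i`), and
* `hne : Φ₀ ≠ Φ₁`, `hne' : Φ₁ ≠ Φ₀ᶜ` (the types are inequivalent under `Aut(K) ⊇ {1, c}`) —

are DERIVED (§1) from the geometric hypotheses «`B_m` is simple» and «`B₀`, `B₁` are not isogenous», by the tree's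
Shimura §8.2 Prop. 26 (`not_isSimple_of_isCMTypeRealisation_of_ne`: two embeddings with the same `Aut(ℂ)`-pattern
in `Φ` make every realisation non-simple — if all of `Φ` lies over one embedding `τ₁` of `k` then `Φ` is the whole
`τ₁`-fibre and any two of its three members have the same pattern) and Shimura §6.1 Corollary
(`exists_semilinear_isogeny_of_forall_mem_iff` at `σ = 1` and `σ = c_K`: realisations of `Φ` and of `Φ`, resp. `Φ̄`,
are isogenous).  Both inputs are unconditional tree theorems (Riemann's theorem discharged).

MAIN (§2, §3): `DihedralSexticPair.hodgeConjectureFor_biproduct_of_isSimple_of_markman` (**`B₀ × B₁`**),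
`DihedralSexticPairCurve.hodgeConjectureFor_biproduct_curveSlots_of_isSimple_of_markman` (family form) and
`…_vec_of_isSimple_of_markman` (**`⨁ ![E, B₀, B₁]`**), with their `AVDominatedBy` corollaries: for `K` a sextic CM
field NOT Galois over `ℚ`, `k ⊆ K` imaginary quadratic (`i : k →+* K`), `E ⊨ (k; Ψ)` a CM elliptic curve,
`B_m ⊨ (K; Φ_m)` SIMPLE abelian threefolds, `B₀ ≁ B₁` — **the Hodge conjecture for `B₀ × B₁`, for `E × B₀ × B₁`, and
for all their isogeny factors, GIVEN ONLY `Markman2025_weilClasses_algebraic_abelianFourfold`**.  HONEST FRAMING: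
conditional on Markman only; `HC_CM` is not asserted; powers are NOT covered.

## References
* [Markman2025SurveySecant] E. Markman, arXiv:2509.23403, Thm. 1.2 and §11.5 Step 2.
* [Shimura1998] G. Shimura, *Abelian Varieties with CM and Modular Functions* (1998), §6.1 Cor. of Thm. 2, §8.2
  Prop. 26, §8.4.  [Pohlmann1968] Ann. of Math. 88, Thm 1.  [MoonenZarhin1999LowDim] Duke 98 (1999), Thm. 0.1.
  [MumfordAV1970] §19.
-/

noncomputable section

open CategoryTheory CategoryTheory.Limits NumberField

/-! ## §1 From «simple» and «not isogenous» to the CM-type hypotheses -/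

namespace Summit.HodgeConjecture.CorCM.DihedralSexticPair

open Literature.AlgebraicGeometry Literature.AlgebraicGeometry.Motives Literature.AlgebraicGeometry.HodgeTheory
open Literature.AlgebraicGeometry.ComplexMultiplication
open Summit.HodgeConjecture.CorCM.NonGaloisField

open scoped Classical

section Geometric

variable {K : Type} [Field K] [NumberField K] [IsCMField K] {k : Type} [Field k] [NumberField k] [IsCMField k]

omit [IsCMField K] in
/-- **A simple realisation of a type of the sextic `K ⊇ i(k)` has a type NOT induced from `k`**: if every member of
`Φ` had the same restriction `τ₁` to `k`, then `Φ` would be the whole `τ₁`-fibre (a member `u` over `τ₁` outside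
`Φ` would put `ū`, over `τ̄₁ ≠ τ₁`, inside), any two of its three members would have the same `Aut(ℂ)`-pattern in
`Φ` (`ρ ∘ s ∈ Φ ⟺ ρ ∘ τ₁ = τ₁`), and Shimura §8.2 Prop. 26 (`not_isSimple_of_isCMTypeRealisation_of_ne`) would
make `A` non-simple. [cite: Shimura1998, §8.2 Prop. 26 and §8.4] -/
theorem exists_mem_comp_ne_of_isSimple (h6 : Module.finrank ℚ K = 6) (h2 : Module.finrank ℚ k = 2)
    (i : k →+* K) {Φ : CMType K} {A : AbelianVariety ℂ} {ι : 𝓞 K →+* End A}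
    {θ : K →+* Module.End ℂ (complexBetti A.X 1)} (hA : IsCMTypeRealisation Φ A ι θ) (hS : A.IsSimple) :
    ∃ s ∈ Φ.1, ∃ s' ∈ Φ.1, s.comp i ≠ s'.comp i := by
  by_contra hall
  push Not at hall
  -- a member `s₀` of `Φ` and its restriction `τ₁`
  obtain ⟨a₀⟩ : Nonempty (K →+* ℂ) := inferInstance
  obtain ⟨s₀, hs₀⟩ : ∃ s, s ∈ Φ.1 := by
    by_cases h : a₀ ∈ Φ.1
    · exact ⟨a₀, h⟩
    · exact ⟨ComplexEmbedding.conjugate a₀,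
        (Φ.2 _).2 (by rw [ComplexEmbedding.involutive_conjugate K a₀]; exact h)⟩
  set τ₁ : k →+* ℂ := s₀.comp i with hτ₁
  have hττ : ComplexEmbedding.conjugate τ₁ ≠ τ₁ := QuarticCM.conjugate_ne τ₁
  have hdich : ∀ s : K →+* ℂ, s.comp i = τ₁ ∨ s.comp i = ComplexEmbedding.conjugate τ₁ := fun s =>
    QuarticCM.eq_or_eq_conjugate_of_quadratic h2 τ₁ (s.comp i)
  -- `Φ` is the `τ₁`-fibre
  have hmem : ∀ u : K →+* ℂ, u ∈ Φ.1 ↔ u.comp i = τ₁ := by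
    intro u
    refine ⟨fun hu => hall u hu s₀ hs₀, fun hu => ?_⟩
    by_contra hu'
    have hc : ComplexEmbedding.conjugate u ∈ Φ.1 :=
      (Φ.2 _).2 (by rw [ComplexEmbedding.involutive_conjugate K u]; exact hu')
    have h1 := hall _ hc s₀ hs₀
    rw [conjugate_comp, hu] at h1
    exact hττ h1
  -- two distinct members of the fibre have the same `Aut(ℂ)`-pattern in `Φ`
  obtain ⟨s, hs, t, ht, hst⟩ : ∃ s ∈ (Finset.univ.filter fun s : K →+* ℂ => s.comp i = τ₁),
      ∃ t ∈ (Finset.univ.filter fun s : K →+* ℂ => s.comp i = τ₁), s ≠ t := by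
    rw [← Finset.one_lt_card, card_fibre_eq_three hττ hdich h6]
    norm_num
  simp only [Finset.mem_filter, Finset.mem_univ, true_and] at hs ht
  refine not_isSimple_of_isCMTypeRealisation_of_ne hA hst (fun ρ => ?_) hS
  rw [hmem, hmem, RingHom.comp_assoc, RingHom.comp_assoc, hs, ht]

/-- **Non-isogenous realisations have types inequivalent under `{1, c}`**: if `Φ₁ = Φ₀` (resp. `Φ₁ = Φ₀ᶜ = Φ̄₀`),
Shimura §6.1 Corollary (`exists_semilinear_isogeny_of_forall_mem_iff` at `σ = 1`, resp. `σ = c_K`) gives an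
isogeny `A₀ → A₁`. [cite: Shimura1998, §6.1 Corollary of Theorem 2, p. 41] -/
theorem cmType_ne_and_ne_compl_of_not_isIsogenous {Φ₀ Φ₁ : CMType K}
    {A₀ : AbelianVariety ℂ} {ι₀ : 𝓞 K →+* End A₀} {θ₀ : K →+* Module.End ℂ (complexBetti A₀.X 1)}
    {A₁ : AbelianVariety ℂ} {ι₁ : 𝓞 K →+* End A₁} {θ₁ : K →+* Module.End ℂ (complexBetti A₁.X 1)}
    (hA₀ : IsCMTypeRealisation Φ₀ A₀ ι₀ θ₀) (hA₁ : IsCMTypeRealisation Φ₁ A₁ ι₁ θ₁)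
    (hni : ¬ AbelianVariety.IsIsogenous A₀ A₁) : Φ₀.1 ≠ Φ₁.1 ∧ Φ₁.1 ≠ Φ₀.1ᶜ := by
  constructor
  · intro heq
    apply hni
    have hΦ' : ∀ s : K →+* ℂ, s ∈ Φ₁.1 ↔ s.comp (RingEquiv.refl K).toRingHom ∈ Φ₀.1 := fun s => by
      rw [RingEquiv.toRingHom_refl, RingHom.comp_id, heq]
    obtain ⟨g, hg, -⟩ := exists_semilinear_isogeny_of_forall_mem_iff (RingEquiv.refl K) hΦ' hA₀ hA₁
    exact ⟨g, hg⟩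
  · intro heq
    apply hni
    have hΦ' : ∀ s : K →+* ℂ, s ∈ Φ₁.1 ↔
        s.comp (IsCMField.complexConj K).toRingEquiv.toRingHom ∈ Φ₀.1 := fun s => by
      have hc : s.comp (IsCMField.complexConj K).toRingEquiv.toRingHom = ComplexEmbedding.conjugate s :=
        RingHom.ext fun a => IsCMField.complexEmbedding_complexConj K s a
      rw [hc, heq, Set.mem_compl_iff, Φ₀.2 s, not_not]
    obtain ⟨g, hg, -⟩ :=
      exists_semilinear_isogeny_of_forall_mem_iff (IsCMField.complexConj K).toRingEquiv hΦ' hA₀ hA₁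
    exact ⟨g, hg⟩

end Geometric

/-! ## §2 `B₀ × B₁` -/

section Pair

variable {K : Type} [Field K] [NumberField K] [IsCMField K] {k : Type} [Field k] [NumberField k] [IsCMField k]
  {A : Fin 2 → AbelianVariety ℂ} {Φ : Fin 2 → CMType K} {ι : ∀ j, 𝓞 K →+* End (A j)}
  {θ : ∀ j, K →+* Module.End ℂ (complexBetti (A j).X 1)}

/-- **The Hodge conjecture for `B₀ × B₁ = ⨁_{j<2} A_j` modulo Markman's fourfold theorem, geometric hypotheses**:
`K` a sextic CM field NOT Galois over `ℚ` containing the imaginary quadratic field `k` (`i`), `A_j ⊨ (K; Φ_j)`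
SIMPLE (CM threefolds) and `A₀ ≁ A₁` — every rational `(p,p)`-class on `⨁ A` is algebraic, GIVEN ONLY
`Markman2025_weilClasses_algebraic_abelianFourfold`. [cite: Markman2025SurveySecant, Thm. 1.2 and §11.5 Step 2]
[cite: Shimura1998, §6.1 Cor., §8.2 Prop. 26] [cite: Pohlmann1968, Thm 1] [cite: MoonenZarhin1999LowDim, Thm. 0.1] -/
theorem hodgeConjectureFor_biproduct_of_isSimple_of_markman
    (hW4 : Markman2025_weilClasses_algebraic_abelianFourfold)
    (h6 : Module.finrank ℚ K = 6) (h2 : Module.finrank ℚ k = 2) (i : k →+* K) (hK : ¬ IsGalois ℚ K)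
    (hA : ∀ j, IsCMTypeRealisation (Φ j) (A j) (ι j) (θ j)) (hS : ∀ j, (A j).IsSimple)
    (hni : ¬ AbelianVariety.IsIsogenous (A 0) (A 1)) :
    HodgeConjectureFor (⨁ A).dim (⨁ A).X :=
  have hne := cmType_ne_and_ne_compl_of_not_isIsogenous (hA 0) (hA 1) hni
  hodgeConjectureFor_biproduct_of_not_isGalois_of_markman hW4 h6 h2 i hK hA
    (fun j => exists_mem_comp_ne_of_isSimple h6 h2 i (hA j) (hS j)) hne.1 hne.2

/-- **The Hodge conjecture for every abelian variety dominated by `B₀ ⊕ B₁`** (its isogeny factors; NOT the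
powers), geometric hypotheses, modulo Markman. [cite: Markman2025SurveySecant, Thm. 1.2] [cite: MumfordAV1970, §19] -/
theorem hodgeConjectureFor_of_avDominatedBy_of_isSimple_of_markman
    (hW4 : Markman2025_weilClasses_algebraic_abelianFourfold)
    (h6 : Module.finrank ℚ K = 6) (h2 : Module.finrank ℚ k = 2) (i : k →+* K) (hK : ¬ IsGalois ℚ K)
    (hA : ∀ j, IsCMTypeRealisation (Φ j) (A j) (ι j) (θ j)) (hS : ∀ j, (A j).IsSimple)
    (hni : ¬ AbelianVariety.IsIsogenous (A 0) (A 1))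
    {B : AbelianVariety ℂ} (hB : Domination.AVDominatedBy B (⨁ A)) : HodgeConjectureFor B.dim B.X :=
  Domination.hodgeConjectureFor_of_avDominatedBy
    (hodgeConjectureFor_biproduct_of_isSimple_of_markman hW4 h6 h2 i hK hA hS hni) hB

end Pair

end Summit.HodgeConjecture.CorCM.DihedralSexticPair

/-! ## §3 `E × B₀ × B₁` -/

namespace Summit.HodgeConjecture.CorCM.DihedralSexticPairCurve

open Literature.AlgebraicGeometry Literature.AlgebraicGeometry.Motives Literature.AlgebraicGeometry.HodgeTheory
open Literature.AlgebraicGeometry.ComplexMultiplication (IsCMTypeRealisation)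
open Summit.HodgeConjecture.CorCM.DihedralSexticPair (exists_mem_comp_ne_of_isSimple
  cmType_ne_and_ne_compl_of_not_isIsogenous)

section Family

variable {I : Type} {Kf : I → Type} [∀ i, Field (Kf i)] [∀ i, NumberField (Kf i)] [∀ i, IsCMField (Kf i)]
  {i₀ i₁ : I}
  {A₃ : Fin 3 → AbelianVariety ℂ} {Φ₃ : ∀ j : Fin 3, CMType (Kf (curveSlots i₀ i₁ j))}
  {ι₃ : ∀ j, 𝓞 (Kf (curveSlots i₀ i₁ j)) →+* End (A₃ j)}
  {θ₃ : ∀ j, Kf (curveSlots i₀ i₁ j) →+* Module.End ℂ (complexBetti (A₃ j).X 1)}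

/-- **The Hodge conjecture for `E × B₀ × B₁ = ⨁ A₃` modulo Markman's fourfold theorem, geometric hypotheses**
(family form): `k = Kf i₀` imaginary quadratic, `K = Kf i₁ ⊇ i(k)` sextic CM NOT Galois, `A₃ 0 ⊨ (k; Φ₃ 0)` a CM
elliptic curve, `A₃ (m+1) ⊨ (K; Φ₃ (m+1))` SIMPLE and `A₃ 1 ≁ A₃ 2` — every rational `(p,p)`-class on `⨁ A₃` is
algebraic, GIVEN ONLY `Markman2025_weilClasses_algebraic_abelianFourfold`.
[cite: Markman2025SurveySecant, Thm. 1.2 and §11.5 Step 2] [cite: Shimura1998, §6.1 Cor., §8.2 Prop. 26]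
[cite: Pohlmann1968, Thm 1] [cite: MoonenZarhin1999LowDim, Thm. 0.1] -/
theorem hodgeConjectureFor_biproduct_curveSlots_of_isSimple_of_markman
    (hW4 : Markman2025_weilClasses_algebraic_abelianFourfold)
    (h6 : Module.finrank ℚ (Kf i₁) = 6) (h2 : Module.finrank ℚ (Kf i₀) = 2) (i : Kf i₀ →+* Kf i₁)
    (hK : ¬ IsGalois ℚ (Kf i₁))
    (hA : ∀ j, IsCMTypeRealisation (Φ₃ j) (A₃ j) (ι₃ j) (θ₃ j)) (hS : ∀ m : Fin 2, (A₃ m.succ).IsSimple)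
    (hni : ¬ AbelianVariety.IsIsogenous (A₃ (Fin.succ 0)) (A₃ (Fin.succ 1))) :
    HodgeConjectureFor (⨁ A₃).dim (⨁ A₃).X :=
  have hne := cmType_ne_and_ne_compl_of_not_isIsogenous (hA (Fin.succ 0)) (hA (Fin.succ 1)) hni
  hodgeConjectureFor_biproduct_curveSlots_of_not_isGalois_of_markman hW4 h6 h2 i hK hA
    (fun m => exists_mem_comp_ne_of_isSimple h6 h2 i (hA m.succ) (hS m)) hne.1 hne.2

/-- **The Hodge conjecture for every abelian variety dominated by `E × B₀ × B₁`** (its isogeny factors; NOT the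
powers), geometric hypotheses, family form, modulo Markman. [cite: Markman2025SurveySecant, Thm. 1.2]
[cite: MumfordAV1970, §19] -/
theorem hodgeConjectureFor_of_avDominatedBy_curveSlots_of_isSimple_of_markman
    (hW4 : Markman2025_weilClasses_algebraic_abelianFourfold)
    (h6 : Module.finrank ℚ (Kf i₁) = 6) (h2 : Module.finrank ℚ (Kf i₀) = 2) (i : Kf i₀ →+* Kf i₁)
    (hK : ¬ IsGalois ℚ (Kf i₁))
    (hA : ∀ j, IsCMTypeRealisation (Φ₃ j) (A₃ j) (ι₃ j) (θ₃ j)) (hS : ∀ m : Fin 2, (A₃ m.succ).IsSimple)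
    (hni : ¬ AbelianVariety.IsIsogenous (A₃ (Fin.succ 0)) (A₃ (Fin.succ 1)))
    {B : AbelianVariety ℂ} (hB : Domination.AVDominatedBy B (⨁ A₃)) : HodgeConjectureFor B.dim B.X :=
  Domination.hodgeConjectureFor_of_avDominatedBy
    (hodgeConjectureFor_biproduct_curveSlots_of_isSimple_of_markman hW4 h6 h2 i hK hA hS hni) hB

end Family

section Vec

variable {k K : Type} [Field k] [NumberField k] [IsCMField k] [Field K] [NumberField K] [IsCMField K]
  {E : AbelianVariety ℂ} {Ψ : CMType k} {ιE : 𝓞 k →+* End E} {θE : k →+* Module.End ℂ (complexBetti E.X 1)}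
  {B₀ B₁ : AbelianVariety ℂ} {Φ₀ Φ₁ : CMType K} {ι₀ : 𝓞 K →+* End B₀} {ι₁ : 𝓞 K →+* End B₁}
  {θ₀ : K →+* Module.End ℂ (complexBetti B₀.X 1)} {θ₁ : K →+* Module.End ℂ (complexBetti B₁.X 1)}

/-- **MAIN THEOREM (geometric form).  The Hodge conjecture for `E × B₀ × B₁ = ⨁ ![E, B₀, B₁]` modulo Markman's
fourfold theorem**: `K` a sextic CM field NOT Galois over `ℚ`, `k` an imaginary quadratic field with `i : k →+* K`,
`E ⊨ (k; Ψ)` a CM elliptic curve, `B₀ ⊨ (K; Φ₀)` and `B₁ ⊨ (K; Φ₁)` SIMPLE abelian threefolds that are NOT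
isogenous — every rational `(p,p)`-class on the abelian sevenfold `⨁ ![E, B₀, B₁]` is algebraic, for every `p`,
GIVEN ONLY `Markman2025_weilClasses_algebraic_abelianFourfold`.
[cite: Markman2025SurveySecant, Thm. 1.2 and §11.5 Step 2] [cite: Shimura1998, §6.1 Cor., §8.2 Prop. 26, §8.4]
[cite: Pohlmann1968, Thm 1] [cite: GaoUllmo2025, Thm 3.1] [cite: MoonenZarhin1999LowDim, Thm. 0.1] -/
theorem hodgeConjectureFor_biproduct_vec_of_isSimple_of_markman
    (hW4 : Markman2025_weilClasses_algebraic_abelianFourfold)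
    (h6 : Module.finrank ℚ K = 6) (h2 : Module.finrank ℚ k = 2) (i : k →+* K) (hK : ¬ IsGalois ℚ K)
    (hE : IsCMTypeRealisation Ψ E ιE θE) (hB₀ : IsCMTypeRealisation Φ₀ B₀ ι₀ θ₀)
    (hB₁ : IsCMTypeRealisation Φ₁ B₁ ι₁ θ₁) (hS₀ : B₀.IsSimple) (hS₁ : B₁.IsSimple)
    (hni : ¬ AbelianVariety.IsIsogenous B₀ B₁) :
    HodgeConjectureFor (⨁ (![E, B₀, B₁] : Fin 3 → AbelianVariety ℂ)).dim
      (⨁ (![E, B₀, B₁] : Fin 3 → AbelianVariety ℂ)).X :=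
  have hne := cmType_ne_and_ne_compl_of_not_isIsogenous hB₀ hB₁ hni
  hodgeConjectureFor_biproduct_vec_of_not_isGalois_of_markman hW4 h6 h2 i hK hE hB₀ hB₁
    (exists_mem_comp_ne_of_isSimple h6 h2 i hB₀ hS₀) (exists_mem_comp_ne_of_isSimple h6 h2 i hB₁ hS₁) hne.1 hne.2

/-- **The Hodge conjecture for every abelian variety dominated by `⨁ ![E, B₀, B₁]`** — its isogeny factors:
`E × B₀ × B₁` in any bracketing, `B_m × E`, `B₀ × B₁`, `B_m`, `E` (NOT the powers) — geometric form, modulo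
Markman. [cite: Markman2025SurveySecant, Thm. 1.2] [cite: MumfordAV1970, §19] -/
theorem hodgeConjectureFor_of_avDominatedBy_vec_of_isSimple_of_markman
    (hW4 : Markman2025_weilClasses_algebraic_abelianFourfold)
    (h6 : Module.finrank ℚ K = 6) (h2 : Module.finrank ℚ k = 2) (i : k →+* K) (hK : ¬ IsGalois ℚ K)
    (hE : IsCMTypeRealisation Ψ E ιE θE) (hB₀ : IsCMTypeRealisation Φ₀ B₀ ι₀ θ₀)
    (hB₁ : IsCMTypeRealisation Φ₁ B₁ ι₁ θ₁) (hS₀ : B₀.IsSimple) (hS₁ : B₁.IsSimple)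
    (hni : ¬ AbelianVariety.IsIsogenous B₀ B₁)
    {B : AbelianVariety ℂ} (hB : Domination.AVDominatedBy B (⨁ (![E, B₀, B₁] : Fin 3 → AbelianVariety ℂ))) :
    HodgeConjectureFor B.dim B.X :=
  Domination.hodgeConjectureFor_of_avDominatedBy
    (hodgeConjectureFor_biproduct_vec_of_isSimple_of_markman hW4 h6 h2 i hK hE hB₀ hB₁ hS₀ hS₁ hni) hB

end Vec

end Summit.HodgeConjecture.CorCM.DihedralSexticPairCurve

end
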